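import Summits.Ventures.HSemireg.WedgeHankelRecurrenceModule
import Summits.Ventures.HSemireg.WedgeHankelSecantRank

/-!
# Venture HSemireg — PRONY: THE MINIMAL RECURRENCE OF A SECANT CLASS IS THE NODE POLYNOMIAL — for distinct nodes `λ_i`, non-zero weights `A_i` (`i < r`) and the window
# `r + k ≤ N + 1`, **the recurrences of window `k + 1` of `q_j = Σ_i A_i λ_i^j` (`j ≤ N`) are exactly the multiples of `Π_i (X − λ_i)` of degree `≤ k`**; hence `Rec_k = 0` for `k < r`,
# `Rec_r = K · Π_i (X − λ_i)` (`2r ≤ N + 1`), `rank H_k = min(k + 1, r)`, `R = r`, and THE NODES ARE THE ROOTS OF THE MINIMAL RECURRENCE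

HONEST FRAMING. Part of the Lean index of the computation cell `pub-hsemireg` (seat p10 gen 26, Sunday typer «UNIFORM-IN-n»).
LINEAR ALGEBRA OF HANKEL (catalecticant) MATRICES and of polynomials over a field ONLY: no variety, no cohomology theory, no sheaf, no Ext group and no semiregularity map is constructed
here; nothing here says that HC / HC_CM / HC_AV holds; no Literature fact is declared or used.  Custodian versions as in `WedgeHankelSiegelIdeal` (1/3); the dictionary (`secSeq A λ` = the
coefficient sequence of the `r`-secant class `Σ_i A_i exp(λ_i Θ)`; a recurrence = a left-kernel vector of `H_k(q)`; «Prony's method») is QUOTED, never asserted.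

WHAT IS IN THE TREE / KEYED.  N18 (`WedgeHankelRecurrenceModule`, claim #1 of p10 g26): `hkFun`, `recSpace`, `mem_recSpace_iff`, `finrank_recSpace_add_rank`, `map_mulRight_degreeLT_le_recSpace`,
`finrank_map_mulRight_degreeLT`, `mem_degreeLT_succ_iff`; D1 (`WedgeHankelSecantRank`, tree) `secSeq`, `wNodeMat`, the Vandermonde minor `transpose_mulVecLin_injective`, and the SECANT RANK LAW
`rank_hankel1_secSeq_eq_min` (re-derived here from the recurrence count, `rank_hankel1_secSeq_eq_min_of_window`); `WedgeHankelFaces.expSeq`.  Mathlib: `Polynomial.pairwise_coprime_X_sub_C`,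
`Finset.prod_dvd_of_coprime`, `Polynomial.natDegree_prod_of_monic`, `Polynomial.mem_roots`.
THIS FILE (namespace `Summit.Ventures.HSemireg.Wedge.HankelOuter` continued; CHAINED on N18; 0 definitions):
* §469 **`hkFun_expSeq`** (`⟪p, A λ^•⟫_s = A λ^s p(λ)`), **`hkFun_secSeq`** (`⟪p, Σ_i A_i λ_i^•⟫_s = Σ_i A_i λ_i^s p(λ_i)`: the Hankel functional of a secant sequence is a weighted evaluation).
* §470 `natDegree_prod_X_sub_C_nodes`, `prod_X_sub_C_nodes_ne_zero`; `mem_recSpace_secSeq_of_forall_eval_eq_zero` (vanishing at the nodes ⇒ recurrence; no hypothesis),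
  **`prod_X_sub_C_mem_recSpace_secSeq`** (`Π_i (X − λ_i) ∈ Rec_r(secSeq A λ)`, every `N`, `A`, `λ`); **`eval_eq_zero_of_mem_recSpace_secSeq`** (distinct nodes, non-zero weights, `r + k ≤ N + 1`:
  a recurrence of window `k + 1` vanishes at every node — the Vandermonde minor); PRONY **`mem_recSpace_secSeq_iff`** (`p ∈ Rec_k ↔ deg p ≤ k ∧ ∀ i, p(λ_i) = 0`),
  `prod_X_sub_C_dvd_iff_forall_eval_eq_zero`, **`mem_recSpace_secSeq_iff_dvd`** (`↔ deg p ≤ k ∧ Π_i (X − λ_i) ∣ p`), **`recSpace_secSeq_eq_bot`** (`k < r`, `r + k ≤ N + 1 ⇒ Rec_k = 0`),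
  **`recSpace_secSeq_self_eq_span`** (`2r ≤ N + 1 ⇒ Rec_r = K · Π_i (X − λ_i)`), **`recSpace_secSeq_eq_map_mulRight`** (`2r + d ≤ N + 1 ⇒ Rec_{r+d} = Π_i (X − λ_i) · K[X]_{≤ d}`).
* §471 **`rank_hankel1_secSeq_eq_min_of_window`** (`r + k ≤ N + 1 ⇒ rank H_k(secSeq A λ) = min(k + 1, r)`, from `dim Rec_k + rank H_k = k + 1`), `rank_hankel1_half_secSeq` (`2r ≤ N + 1 ⇒ R = r`),
  **`roots_eq_of_mem_recSpace_secSeq`** (`2r ≤ N + 1`: every non-zero `m ∈ Rec_r` has `m.roots.toFinset = {λ_i}` — THE NODES ARE READ OFF THE MINIMAL RECURRENCE).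
READING: with N18 the class `w_N(secSeq A λ)` determines, from `2r ≤ N + 1` coefficients on, the node polynomial and hence the node SET `{λ_i}` (Prony 1795); D1's rank law is the
dimension count of the same statement.  Nothing Ext-side.  New names only.
-/

open Module Polynomial
open scoped Matrix Polynomial

namespace Summit.Ventures.HSemireg.Wedge.HankelOuter

open Summit.Ventures.HSemireg.Wedge Summit.Ventures.HSemireg.Wedge.Hankel Summit.Ventures.HSemireg.Wedge.HankelSecant
  Summit.Ventures.HSemireg.Wedge.HankelFaces

variable (K : Type*) [Field K] {N : ℕ}

/-! ## §469. The Hankel functional of a pure / secant sequence is a weighted evaluation -/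

/-- `⟪p, A λ^•⟫_s = A · λ^s · p(λ)`. -/
theorem hkFun_expSeq (A lam : K) (s : ℕ) (p : K[X]) : hkFun K (expSeq K A lam) s p = A * lam ^ s * p.eval lam := by
  induction p using Polynomial.induction_on' with
  | add p p' hp hp' => rw [map_add, hp, hp', Polynomial.eval_add, mul_add]
  | monomial i c =>
    simp only [hkFun_monomial, Polynomial.eval_monomial, expSeq, pow_add]
    ring

/-- `⟪p, Σ_i A_i λ_i^•⟫_s = Σ_i A_i · λ_i^s · p(λ_i)`. -/
theorem hkFun_secSeq {r : ℕ} (A lam : Fin r → K) (s : ℕ) (p : K[X]) :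
    hkFun K (secSeq K A lam) s p = ∑ i, A i * lam i ^ s * p.eval (lam i) := by
  induction p using Polynomial.induction_on' with
  | add p p' hp hp' =>
    rw [map_add, hp, hp', ← Finset.sum_add_distrib]
    exact Finset.sum_congr rfl fun i _ => by rw [Polynomial.eval_add, mul_add]
  | monomial i c =>
    simp only [hkFun_monomial, Polynomial.eval_monomial, secSeq, Finset.mul_sum]
    exact Finset.sum_congr rfl fun j _ => by rw [pow_add]; ring

/-! ## §470. The node polynomial is a recurrence; Prony: inside the window the recurrences are exactly its multiples -/

/-- the NODE POLYNOMIAL `Π_i (X − λ_i)` has degree `r`. -/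
theorem natDegree_prod_X_sub_C_nodes {r : ℕ} (lam : Fin r → K) : (∏ i, (Polynomial.X - Polynomial.C (lam i))).natDegree = r := by
  rw [Polynomial.natDegree_prod_of_monic _ _ fun i _ => Polynomial.monic_X_sub_C (lam i)]
  simp only [Polynomial.natDegree_X_sub_C, Finset.sum_const, Finset.card_univ, Fintype.card_fin, smul_eq_mul, mul_one]

/-- the node polynomial is non-zero. -/
theorem prod_X_sub_C_nodes_ne_zero {r : ℕ} (lam : Fin r → K) : (∏ i, (Polynomial.X - Polynomial.C (lam i))) ≠ 0 :=
  (Polynomial.monic_prod_of_monic _ _ fun i _ => Polynomial.monic_X_sub_C (lam i)).ne_zero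

/-- a polynomial vanishing at every node is a recurrence of the secant sequence (every window `≥ deg p + 1`, no hypothesis on the nodes or weights). -/
theorem mem_recSpace_secSeq_of_forall_eval_eq_zero {r : ℕ} (A lam : Fin r → K) {k : ℕ} {p : K[X]} (hp : p ∈ Polynomial.degreeLT K (k + 1))
    (h0 : ∀ i, p.eval (lam i) = 0) : p ∈ recSpace K N (secSeq K A lam) k := by
  rw [mem_recSpace_iff]
  refine ⟨hp, fun s _ => ?_⟩
  rw [hkFun_secSeq]
  exact Finset.sum_eq_zero fun i _ => by rw [h0 i, mul_zero]

/-- **THE NODE POLYNOMIAL IS A RECURRENCE: `Π_i (X − λ_i) ∈ Rec_r(Σ_i A_i λ_i^•)`** (every `N`, every weights and nodes). -/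
theorem prod_X_sub_C_mem_recSpace_secSeq {r : ℕ} (A lam : Fin r → K) :
    (∏ i, (Polynomial.X - Polynomial.C (lam i))) ∈ recSpace K N (secSeq K A lam) r := by
  refine mem_recSpace_secSeq_of_forall_eval_eq_zero K A lam ((mem_degreeLT_succ_iff K).mpr (natDegree_prod_X_sub_C_nodes K lam).le) fun i => ?_
  rw [Polynomial.eval_prod]
  exact Finset.prod_eq_zero (Finset.mem_univ i) (by rw [Polynomial.eval_sub, Polynomial.eval_X, Polynomial.eval_C, sub_self])

/-- **inside the window `r + k ≤ N + 1` (distinct nodes, non-zero weights) a recurrence of window `k + 1` VANISHES AT EVERY NODE** (a Vandermonde minor). -/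
theorem eval_eq_zero_of_mem_recSpace_secSeq {r : ℕ} {A lam : Fin r → K} (hA : ∀ i, A i ≠ 0) (hlam : Function.Injective lam) {k : ℕ}
    (hk : r + k ≤ N + 1) {p : K[X]} (hp : p ∈ recSpace K N (secSeq K A lam) k) (i : Fin r) : p.eval (lam i) = 0 := by
  rw [mem_recSpace_iff] at hp
  have hinj := transpose_mulVecLin_injective (c := N + 1 - k) (by omega) hA hlam
  have hzero : (wNodeMat A lam (N + 1 - k))ᵀ.mulVecLin (fun i => p.eval (lam i)) = 0 := by
    funext l
    rw [Matrix.mulVecLin_apply, Pi.zero_apply, Matrix.mulVec_transpose]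
    have := hp.2 (l : ℕ) (by have := l.2; omega)
    rw [hkFun_secSeq] at this
    rw [← this]
    simp only [Matrix.vecMul, dotProduct, wNodeMat_apply]
    exact Finset.sum_congr rfl fun i _ => by ring
  have := hinj (hzero.trans (map_zero _).symm)
  exact congrFun this i

/-- **PRONY'S THEOREM (membership form): for distinct nodes, non-zero weights and `r + k ≤ N + 1`, `p ∈ Rec_k(Σ_i A_i λ_i^•)` iff `deg p ≤ k` and `p(λ_i) = 0` for all `i`.** -/
theorem mem_recSpace_secSeq_iff {r : ℕ} {A lam : Fin r → K} (hA : ∀ i, A i ≠ 0) (hlam : Function.Injective lam) {k : ℕ}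
    (hk : r + k ≤ N + 1) {p : K[X]} :
    p ∈ recSpace K N (secSeq K A lam) k ↔ p ∈ Polynomial.degreeLT K (k + 1) ∧ ∀ i, p.eval (lam i) = 0 :=
  ⟨fun hp => ⟨recSpace_le_degreeLT K _ k hp, eval_eq_zero_of_mem_recSpace_secSeq K hA hlam hk hp⟩,
    fun h => mem_recSpace_secSeq_of_forall_eval_eq_zero K A lam h.1 h.2⟩

/-- vanishing at the distinct nodes means divisibility by the node polynomial. -/
theorem prod_X_sub_C_dvd_iff_forall_eval_eq_zero {r : ℕ} {lam : Fin r → K} (hlam : Function.Injective lam) (p : K[X]) :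
    (∏ i, (Polynomial.X - Polynomial.C (lam i))) ∣ p ↔ ∀ i, p.eval (lam i) = 0 := by
  constructor
  · rintro ⟨g, rfl⟩ i
    rw [Polynomial.eval_mul, Polynomial.eval_prod]
    rw [Finset.prod_eq_zero (Finset.mem_univ i) (by rw [Polynomial.eval_sub, Polynomial.eval_X, Polynomial.eval_C, sub_self]), zero_mul]
  · intro h
    exact Finset.prod_dvd_of_coprime ((Polynomial.pairwise_coprime_X_sub_C hlam).set_pairwise _)
      fun i _ => Polynomial.dvd_iff_isRoot.mpr (h i)

/-- **PRONY'S THEOREM (divisibility form): for `r + k ≤ N + 1`, `p ∈ Rec_k(Σ_i A_i λ_i^•)` iff `deg p ≤ k` and `Π_i (X − λ_i) ∣ p`** — the recurrences of the secant sequence inside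
the window are exactly the multiples of the node polynomial. -/
theorem mem_recSpace_secSeq_iff_dvd {r : ℕ} {A lam : Fin r → K} (hA : ∀ i, A i ≠ 0) (hlam : Function.Injective lam) {k : ℕ}
    (hk : r + k ≤ N + 1) {p : K[X]} :
    p ∈ recSpace K N (secSeq K A lam) k ↔ p ∈ Polynomial.degreeLT K (k + 1) ∧ (∏ i, (Polynomial.X - Polynomial.C (lam i))) ∣ p := by
  rw [mem_recSpace_secSeq_iff K hA hlam hk, prod_X_sub_C_dvd_iff_forall_eval_eq_zero K hlam]

/-- **no recurrence of window `≤ r`: `Rec_k(Σ_i A_i λ_i^•) = 0` for `k < r ≤ N + 1 − k`.** -/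
theorem recSpace_secSeq_eq_bot {r : ℕ} {A lam : Fin r → K} (hA : ∀ i, A i ≠ 0) (hlam : Function.Injective lam) {k : ℕ}
    (hkr : k < r) (hk : r + k ≤ N + 1) : recSpace K N (secSeq K A lam) k = ⊥ := by
  rw [Submodule.eq_bot_iff]
  intro p hp
  obtain ⟨hdeg, hdvd⟩ := (mem_recSpace_secSeq_iff_dvd K hA hlam hk).mp hp
  by_contra hne
  have h1 := Polynomial.natDegree_le_of_dvd hdvd hne
  rw [natDegree_prod_X_sub_C_nodes] at h1
  have h2 := (mem_degreeLT_succ_iff K).mp hdeg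
  omega

/-- **THE MINIMAL RECURRENCE OF A SECANT CLASS IS THE NODE POLYNOMIAL: `Rec_r(Σ_i A_i λ_i^•) = K · Π_i (X − λ_i)` for `2r ≤ N + 1`** (distinct nodes, non-zero weights). -/
theorem recSpace_secSeq_self_eq_span {r : ℕ} {A lam : Fin r → K} (hA : ∀ i, A i ≠ 0) (hlam : Function.Injective lam) (hr : r + r ≤ N + 1) :
    recSpace K N (secSeq K A lam) r = K ∙ ∏ i, (Polynomial.X - Polynomial.C (lam i)) := by
  refine le_antisymm (fun p hp => ?_) ((Submodule.span_singleton_le_iff_mem _ _).mpr (prod_X_sub_C_mem_recSpace_secSeq K A lam))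
  obtain ⟨hdeg, g, rfl⟩ := (mem_recSpace_secSeq_iff_dvd K hA hlam hr).mp hp
  rw [Submodule.mem_span_singleton]
  by_cases hg : g = 0
  · exact ⟨0, by rw [hg, mul_zero, zero_smul]⟩
  · have h1 := (mem_degreeLT_succ_iff K).mp hdeg
    rw [Polynomial.natDegree_mul (prod_X_sub_C_nodes_ne_zero K lam) hg, natDegree_prod_X_sub_C_nodes] at h1
    obtain ⟨c, hc⟩ : ∃ c : K, g = Polynomial.C c := ⟨g.coeff 0, Polynomial.eq_C_of_natDegree_eq_zero (by omega)⟩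
    exact ⟨c, by rw [hc, mul_comm, Polynomial.C_mul', ]⟩

/-- **PRONY (module form): for `2r + d ≤ N + 1`, `Rec_{r+d}(Σ_i A_i λ_i^•) = Π_i (X − λ_i) · K[X]_{≤ d}`.** -/
theorem recSpace_secSeq_eq_map_mulRight {r : ℕ} {A lam : Fin r → K} (hA : ∀ i, A i ≠ 0) (hlam : Function.Injective lam) {d : ℕ}
    (hd : r + d + r ≤ N + 1) :
    recSpace K N (secSeq K A lam) (r + d) = (Polynomial.degreeLT K (d + 1)).map (LinearMap.mulRight K (∏ i, (Polynomial.X - Polynomial.C (lam i)))) := by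
  refine le_antisymm (fun p hp => ?_) (map_mulRight_degreeLT_le_recSpace K (prod_X_sub_C_mem_recSpace_secSeq K A lam) d)
  obtain ⟨hdeg, g, rfl⟩ := (mem_recSpace_secSeq_iff_dvd K hA hlam (by omega)).mp hp
  refine ⟨g, ?_, by rw [LinearMap.mulRight_apply, mul_comm]⟩
  by_cases hg : g = 0
  · rw [hg]; exact Submodule.zero_mem _
  · have h1 := (mem_degreeLT_succ_iff K).mp hdeg
    rw [Polynomial.natDegree_mul (prod_X_sub_C_nodes_ne_zero K lam) hg, natDegree_prod_X_sub_C_nodes] at h1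
    exact (mem_degreeLT_succ_iff K).mpr (by omega)

/-! ## §471. The rank census of a secant class from its recurrences: `R = r`, and the nodes are the roots of the minimal recurrence -/

/-- **`rank H_k(Σ_i A_i λ_i^•) = min(k + 1, r)` for `r + k ≤ N + 1`** (re-derived from the recurrence count). -/
theorem rank_hankel1_secSeq_eq_min_of_window {r : ℕ} {A lam : Fin r → K} (hA : ∀ i, A i ≠ 0) (hlam : Function.Injective lam) {k : ℕ}
    (hk : r + k ≤ N + 1) : (hankel1 K N k (secSeq K A lam)).rank = min (k + 1) r := by
  have h := finrank_recSpace_add_rank K (N := N) k (secSeq K A lam)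
  rcases Nat.lt_or_ge k r with hlt | hle
  · rw [recSpace_secSeq_eq_bot K hA hlam hlt hk, finrank_bot] at h
    rw [min_eq_left (by omega)]
    omega
  · obtain ⟨d, rfl⟩ := Nat.exists_eq_add_of_le hle
    rw [recSpace_secSeq_eq_map_mulRight K hA hlam (by omega), finrank_map_mulRight_degreeLT K (prod_X_sub_C_nodes_ne_zero K lam)] at h
    rw [min_eq_right (by omega)]
    omega

/-- **`R(Σ_i A_i λ_i^•) = r` for `2r ≤ N + 1`**: the middle rank of a secant class is its number of nodes. -/
theorem rank_hankel1_half_secSeq {r : ℕ} {A lam : Fin r → K} (hA : ∀ i, A i ≠ 0) (hlam : Function.Injective lam) (hr : r + r ≤ N + 1) :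
    (hankel1 K N (N / 2) (secSeq K A lam)).rank = r := by
  rw [rank_hankel1_secSeq_eq_min_of_window K hA hlam (by omega), min_eq_right (by omega)]

/-- **THE NODES ARE THE ROOTS OF THE MINIMAL RECURRENCE** (Prony's recipe): for `2r ≤ N + 1`, every non-zero `m ∈ Rec_r(Σ_i A_i λ_i^•)` has root set `{λ_i}`. -/
theorem roots_eq_of_mem_recSpace_secSeq [DecidableEq K] {r : ℕ} {A lam : Fin r → K} (hA : ∀ i, A i ≠ 0) (hlam : Function.Injective lam)
    (hr : r + r ≤ N + 1) {m : K[X]} (hm : m ∈ recSpace K N (secSeq K A lam) r) (hm0 : m ≠ 0) :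
    m.roots.toFinset = Finset.univ.image lam := by
  rw [recSpace_secSeq_self_eq_span K hA hlam hr, Submodule.mem_span_singleton] at hm
  obtain ⟨c, rfl⟩ := hm
  have hc : c ≠ 0 := by rintro rfl; exact hm0 (zero_smul _ _)
  ext x
  rw [Multiset.mem_toFinset, Polynomial.mem_roots hm0, Finset.mem_image]
  rw [Polynomial.IsRoot.def, Polynomial.eval_smul, smul_eq_mul, mul_eq_zero, Polynomial.eval_prod, Finset.prod_eq_zero_iff]
  simp only [hc, false_or, Finset.mem_univ, true_and, Polynomial.eval_sub, Polynomial.eval_X, Polynomial.eval_C, sub_eq_zero]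
  exact ⟨fun ⟨i, hi⟩ => ⟨i, hi.symm⟩, fun ⟨i, hi⟩ => ⟨i, hi.symm⟩⟩

end Summit.Ventures.HSemireg.Wedge.HankelOuter
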